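import Mathlib.Analysis.SpecialFunctions.Pow.Asymptotics
import Mathlib.RingTheory.Polynomial.GaussLemma
import Mathlib.FieldTheory.Perfect
import Summits.Parity.BatemanHorn.Theorems.SoloInformedRootIteratedDeriv
import Summits.Parity.BatemanHorn.Theorems.SoloInformedNewtonSpacing
import Summits.Parity.BatemanHorn.Theorems.SoloInformedPolynomialGrowth

/-!
# `k`-th power values of an irreducible integer polynomial are `o(x / log x)`, all `k ≥ 2`

SOLOIST deliverable (unit `solo-Parity-informed`, session 15): the elementary divided-difference bound.
For `g ∈ ℤ[X]` irreducible of degree `d ≥ 1` with positive leading coefficient and any `k ≥ 2`,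
`#{n ≤ x : |g(n)| = m^k for some m} · log x ≤ δ x` eventually, for every `δ > 0`
(`eventually_card_powValues_mul_log_le_of_irreducible`).

Argument (Jarník; Bombieri–Pila in its crudest form).  Put `s = ⌊d/k⌋ + 1` and `φ = G^{1/k}`,
`G = g ⊗ ℝ`.  By `SoloInformedRootIteratedDeriv`, `φ^{(s)}` does not vanish for large `t` (this uses the
separability of `G`, i.e. the irreducibility of `g`) and `|φ^{(s)}(t)| ≤ M t^{d/k - s}`; by
`SoloInformedNewtonSpacing`, any `s + 1` solutions `y ≤ n_0 < ⋯ < n_s` satisfy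
`1 ≤ M y^{d/k-s} (n_s - n_0)^{s(s+1)}` (`exists_spacing_powValues_all`).  With `y = √x` this forces blocks
of `s + 1` consecutive solutions in `[√x, x]` to have width `≫ x^{η}`, `η = (s - d/k)/(2s(s+1)) > 0`, whence
the count is `≪ x^{1-η} = o(x / log x)` (`card_le_mul_of_block_spacing`).
-/

namespace Summit.Parity.BatemanHorn.Theorems

open Finset Filter Polynomial Asymptotics
open scoped Topology

/-! ### Algebraic input: separability over `ℝ` -/

/-- An irreducible integer polynomial of positive degree is separable over `ℝ`. -/
theorem separable_map_real_of_irreducible {g : ℤ[X]} (hirr : Irreducible g) (hdeg : 1 ≤ g.natDegree) :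
    (g.map (Int.castRingHom ℝ)).Separable := by
  have hprim : g.IsPrimitive := hirr.isPrimitive (by omega)
  have hirrQ : Irreducible (g.map (Int.castRingHom ℚ)) :=
    (Polynomial.IsPrimitive.Int.irreducible_iff_irreducible_map_cast hprim).mp hirr
  have hsepQ : (g.map (Int.castRingHom ℚ)).Separable := hirrQ.separable
  have h := hsepQ.map (f := algebraMap ℚ ℝ)
  rwa [Polynomial.map_map, RingHom.eq_intCast' ((algebraMap ℚ ℝ).comp (Int.castRingHom ℚ))] at h

/-- At a solution `n` of `|g(n)| = m^k` with `G(n) > 0` (`G = g ⊗ ℝ`), `φ(n) = G(n)^{1/k} = m`. -/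
theorem polyRootFun_natCast_eq_of_natAbs_eq_pow (g : ℤ[X]) {k : ℕ} (hk : k ≠ 0) {n m : ℕ}
    (hpos : 0 < (g.map (Int.castRingHom ℝ)).eval (n : ℝ)) (hm : (g.eval (n : ℤ)).natAbs = m ^ k) :
    polyRootFun (g.map (Int.castRingHom ℝ)) (k : ℝ)⁻¹ n = m := by
  have hGn : (g.map (Int.castRingHom ℝ)).eval (n : ℝ) = ((g.eval (n : ℤ) : ℤ) : ℝ) := by
    rw [eval_natCast_map_intCast]
  have hgpos : 0 < g.eval (n : ℤ) := by
    have h := hpos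
    rw [hGn] at h
    exact_mod_cast h
  have hgm : g.eval (n : ℤ) = (m : ℤ) ^ k := by
    rw [← Int.natAbs_of_nonneg hgpos.le, hm]
    push_cast
    ring
  unfold polyRootFun
  rw [hGn, hgm]
  push_cast
  exact Real.pow_rpow_inv_natCast (Nat.cast_nonneg m) hk

/-! ### Spacing of `s + 1` solutions -/

/-- **Spacing of `k`-th power values.**  For `g ∈ ℤ[X]` separable over `ℝ`, of degree `d ≥ 1`, positive
leading coefficient, `k ≥ 2` and `s ≥ 1` with `d ≤ k s`: there are `T₁ ≥ 1`, `M > 0` such that for `y ≥ T₁`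
and naturals `y ≤ n_0 < ⋯ < n_s` at which `|g|` takes `k`-th power values,
`1 ≤ M y^{d/k - s} (n_s - n_0)^{s(s+1)}`. -/
theorem exists_spacing_powValues_all {g : ℤ[X]} (hsep : (g.map (Int.castRingHom ℝ)).Separable)
    (hdeg : 1 ≤ g.natDegree) (hlc : 0 < g.leadingCoeff) {k : ℕ} (hk : 2 ≤ k) (s : ℕ) (hs : 1 ≤ s)
    (hks : g.natDegree ≤ k * s) :
    ∃ T₁ M : ℝ, 1 ≤ T₁ ∧ 0 < M ∧ ∀ y : ℝ, T₁ ≤ y → ∀ n : Fin (s + 1) → ℕ, StrictMono n →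
      y ≤ n 0 → (∀ i, ∃ m : ℕ, (g.eval (n i : ℤ)).natAbs = m ^ k) →
        1 ≤ M * y ^ ((g.natDegree : ℝ) / k - s) * ((n (Fin.last s) : ℝ) - n 0) ^ (s * (s + 1)) := by
  set G : ℝ[X] := g.map (Int.castRingHom ℝ) with hG
  have hinj : Function.Injective (Int.castRingHom ℝ) := Int.cast_injective
  have hdegG : G.natDegree = g.natDegree := natDegree_map_eq_of_injective hinj _
  have hlcG : 0 < G.leadingCoeff := by
    rw [hG, leadingCoeff_map_of_injective hinj]
    simp only [eq_intCast]
    exact_mod_cast hlc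
  have hH : rootIterPoly G (k : ℝ)⁻¹ s ≠ 0 := rootIterPoly_ne_zero G hk (by omega) hlcG hsep s
  obtain ⟨T₀, M, hT₀, hM, hB⟩ := exists_rootIterFun_bounds G hk (by omega) hlcG hs hH
  have hGpos : ∀ t, T₀ < t → 0 < G.eval t := fun t ht => (hB t ht.le).1
  have hf := contDiffOn_polyRootFun G (k : ℝ)⁻¹ hGpos s
  have hne : ∀ t, T₀ < t → iteratedDeriv s (polyRootFun G (k : ℝ)⁻¹) t ≠ 0 := fun t ht => by
    rw [iteratedDeriv_polyRootFun_eq G _ hGpos s t ht]; exact (hB t ht.le).2.1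
  have hbd : ∀ t, T₀ < t → |iteratedDeriv s (polyRootFun G (k : ℝ)⁻¹) t|
      ≤ M * t ^ ((g.natDegree : ℝ) / k - s) := fun t ht => by
    rw [iteratedDeriv_polyRootFun_eq G _ hGpos s t ht, ← hdegG]; exact (hB t ht.le).2.2
  have hk0 : (0 : ℝ) < k := by exact_mod_cast (show 0 < k by omega)
  have he : (g.natDegree : ℝ) / k - s ≤ 0 := by
    rw [sub_nonpos, div_le_iff₀ hk0]
    exact_mod_cast (show g.natDegree ≤ s * k by rw [mul_comm]; exact hks)
  refine ⟨T₀ + 1, M, by linarith, hM, fun y hy n hn hyn hm => ?_⟩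
  -- extend the nodes to a strictly increasing sequence `x : ℕ → ℝ`
  let x : ℕ → ℝ := fun i => if h : i ≤ s then (n ⟨i, Nat.lt_succ_of_le h⟩ : ℝ)
    else (n (Fin.last s) : ℝ) + ((i - s : ℕ) : ℝ)
  have hx_lo : ∀ i (h : i ≤ s), x i = n ⟨i, Nat.lt_succ_of_le h⟩ := fun i h => by
    simp only [x, dif_pos h]
  have hx_hi : ∀ i, s < i → x i = (n (Fin.last s) : ℝ) + ((i - s : ℕ) : ℝ) := fun i h => by
    simp only [x, dif_neg (not_le.mpr h)]
  have hx0 : x 0 = n 0 := hx_lo 0 (Nat.zero_le _)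
  have hxs : x s = n (Fin.last s) := hx_lo s le_rfl
  have hx : StrictMono x := by
    refine strictMono_nat_of_lt_succ fun i => ?_
    rcases lt_trichotomy (i + 1) s with h | h | h
    · rw [hx_lo i (by omega), hx_lo (i + 1) (by omega)]
      exact_mod_cast hn (Fin.mk_lt_mk.mpr (Nat.lt_succ_self i))
    · rw [hx_lo i (by omega), hx_lo (i + 1) (by omega)]
      exact_mod_cast hn (Fin.mk_lt_mk.mpr (Nat.lt_succ_self i))
    · rcases (show i = s ∨ s < i by omega) with rfl | hi
      · rw [hxs, hx_hi (i + 1) (by omega), Nat.add_sub_cancel_left]; push_cast; linarith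
      · rw [hx_hi i hi, hx_hi (i + 1) (by omega)]
        have : ((i - s : ℕ) : ℝ) < ((i + 1 - s : ℕ) : ℝ) := by
          exact_mod_cast (show i - s < i + 1 - s by omega)
        linarith
  have hy0 : 0 < y := by linarith
  have hxi : ∀ i ≤ s, ∃ z : ℤ, x i = z := fun i hi => ⟨(n ⟨i, Nat.lt_succ_of_le hi⟩ : ℤ), by
    rw [hx_lo i hi]; push_cast; rfl⟩
  have hfi : ∀ i ≤ s, ∃ z : ℤ, polyRootFun G (k : ℝ)⁻¹ (x i) = z := by
    intro i hi
    obtain ⟨m, hm'⟩ := hm ⟨i, Nat.lt_succ_of_le hi⟩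
    refine ⟨m, ?_⟩
    rw [hx_lo i hi]
    have hνy : y ≤ (n ⟨i, Nat.lt_succ_of_le hi⟩ : ℝ) :=
      hyn.trans (by exact_mod_cast hn.monotone (Fin.zero_le _))
    have hpos : 0 < G.eval ((n ⟨i, Nat.lt_succ_of_le hi⟩ : ℕ) : ℝ) := hGpos _ (by linarith)
    rw [polyRootFun_natCast_eq_of_natAbs_eq_pow g (by omega) hpos hm']
    push_cast; rfl
  have h := one_le_mul_rpow_mul_pow_of_iteratedDeriv he hM.le hf hne hbd hx hxi hfi hy0
    (by linarith) (by rw [hx0]; exact hyn)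
  rwa [hxs, hx0] at h

/-! ### Counting with block spacing -/

/-- From a finset of naturals with at least `s + 1` elements, extract `s + 1` of them in increasing order. -/
theorem exists_strictMono_mem_of_le_card {S : Finset ℕ} {s : ℕ} (hS : s + 1 ≤ #S) :
    ∃ n : Fin (s + 1) → ℕ, StrictMono n ∧ ∀ i, n i ∈ S := by
  refine ⟨fun i => S.orderEmbOfFin rfl (Fin.castLEOrderEmb hS i), ?_, fun i => orderEmbOfFin_mem S rfl _⟩
  exact (S.orderEmbOfFin rfl).strictMono.comp (Fin.castLEOrderEmb hS).strictMono

/-- **Block counting.**  If `T ⊆ [N₀, x]` and any `s + 1` elements of `T` span a width `≥ L > 0`, then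
`#T ≤ s ((x - N₀)/L + 1)`. -/
theorem card_le_mul_of_block_spacing {T : Finset ℕ} {N₀ x : ℕ} (hT : T ⊆ Icc N₀ x) (hx : N₀ ≤ x)
    {L : ℝ} (hL : 0 < L) (s : ℕ)
    (hsep : ∀ a ∈ T, ∀ b ∈ T, a ≤ b → s + 1 ≤ #(T.filter fun n => a ≤ n ∧ n ≤ b) → L ≤ (b : ℝ) - a) :
    (#T : ℝ) ≤ s * (((x : ℝ) - N₀) / L + 1) := by
  have hx' : (0 : ℝ) ≤ (x : ℝ) - N₀ := by
    have : (N₀ : ℝ) ≤ x := by exact_mod_cast hx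
    linarith
  set φ : ℕ → ℕ := fun n => ⌊((n : ℝ) - N₀) / L⌋₊ with hφ
  have himg : T.image φ ⊆ range (⌊((x : ℝ) - N₀) / L⌋₊ + 1) := by
    intro j hj
    obtain ⟨n, hn, rfl⟩ := mem_image.mp hj
    have hnx : n ≤ x := (mem_Icc.mp (hT hn)).2
    rw [mem_range, Nat.lt_succ_iff, hφ]
    exact Nat.floor_le_floor (div_le_div_of_nonneg_right (by gcongr) hL.le)
  -- two elements with the same block index are `< L` apart
  have hclose : ∀ p ∈ T, ∀ r ∈ T, p ≤ r → φ p = φ r → (r : ℝ) - p < L := by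
    intro p hp r hr hpr hφpr
    have hN₀p : (N₀ : ℝ) ≤ p := by exact_mod_cast (mem_Icc.mp (hT hp)).1
    have hup : 0 ≤ ((p : ℝ) - N₀) / L := div_nonneg (by linarith) hL.le
    have h1 : (⌊((p : ℝ) - N₀) / L⌋₊ : ℝ) ≤ ((p : ℝ) - N₀) / L := Nat.floor_le hup
    have h2 : ((r : ℝ) - N₀) / L < (⌊((r : ℝ) - N₀) / L⌋₊ : ℝ) + 1 := Nat.lt_floor_add_one _
    have h3 : (⌊((p : ℝ) - N₀) / L⌋₊ : ℝ) = (⌊((r : ℝ) - N₀) / L⌋₊ : ℝ) := by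
      simp only [hφ] at hφpr
      exact_mod_cast hφpr
    have h4 : ((r : ℝ) - N₀) / L < ((p : ℝ) - N₀) / L + 1 := by linarith
    rw [div_lt_iff₀ hL, add_mul, div_mul_cancel₀ _ hL.ne', one_mul] at h4
    linarith
  -- every fibre has at most `s` elements
  have hfib : ∀ j ∈ T.image φ, #(T.filter fun n => φ n = j) ≤ s := by
    intro j _
    by_contra h
    push Not at h
    set F := T.filter (fun n => φ n = j) with hF
    have hFne : F.Nonempty := card_pos.mp (by omega)
    set a := F.min' hFne with ha
    set b := F.max' hFne with hb
    have haF : a ∈ F := min'_mem F hFne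
    have hbF : b ∈ F := max'_mem F hFne
    obtain ⟨haT, haj⟩ := mem_filter.mp haF
    obtain ⟨hbT, hbj⟩ := mem_filter.mp hbF
    have hab : a ≤ b := min'_le F b hbF
    have hsub : F ⊆ T.filter (fun n => a ≤ n ∧ n ≤ b) := by
      intro n hn
      exact mem_filter.mpr ⟨(mem_filter.mp hn).1, min'_le F n hn, le_max' F n hn⟩
    have hcard : s + 1 ≤ #(T.filter fun n => a ≤ n ∧ n ≤ b) :=
      (Nat.succ_le_of_lt h).trans (card_le_card hsub)
    have h1 := hsep a haT b hbT hab hcard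
    have h2 := hclose a haT b hbT hab (haj.trans hbj.symm)
    linarith
  have hcard := card_le_mul_card_image T s hfib
  have himg' := card_le_card himg
  rw [card_range] at himg'
  calc (#T : ℝ) ≤ ((s * #(T.image φ) : ℕ) : ℝ) := by exact_mod_cast hcard
    _ ≤ ((s * (⌊((x : ℝ) - N₀) / L⌋₊ + 1) : ℕ) : ℝ) := by exact_mod_cast Nat.mul_le_mul_left s himg'
    _ ≤ s * (((x : ℝ) - N₀) / L + 1) := by
        push_cast
        gcongr
        exact Nat.floor_le (div_nonneg hx' hL.le)

/-- From `1 ≤ c W^q` (`c > 0`, `W ≥ 0`, `q ≠ 0`): `(c⁻¹)^{1/q} ≤ W`. -/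
theorem inv_rpow_inv_le_of_one_le_mul {c W : ℝ} {q : ℕ} (hq : q ≠ 0) (hc : 0 < c) (hW : 0 ≤ W)
    (h : 1 ≤ c * W ^ q) : c⁻¹ ^ ((q : ℕ) : ℝ)⁻¹ ≤ W := by
  have h1 : c⁻¹ ≤ W ^ q := by rw [inv_le_iff_one_le_mul₀ hc]; linarith
  calc c⁻¹ ^ ((q : ℕ) : ℝ)⁻¹ ≤ (W ^ q) ^ ((q : ℕ) : ℝ)⁻¹ :=
        Real.rpow_le_rpow (by positivity) h1 (by positivity)
    _ = W := Real.pow_rpow_inv_natCast hW hq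

/-! ### The count -/

open scoped Classical in
/-- **The `n ≤ x` at which `|g(n)|` is a `k`-th power are `o(x / log x)`, for every `k ≥ 2`** (`g ∈ ℤ[X]`
irreducible of degree `≥ 1` with positive leading coefficient). -/
theorem eventually_card_powValues_mul_log_le_of_irreducible {g : ℤ[X]} (hirr : Irreducible g)
    (hdeg : 1 ≤ g.natDegree) (hlc : 0 < g.leadingCoeff) {k : ℕ} (hk : 2 ≤ k) {δ : ℝ} (hδ : 0 < δ) :
    ∀ᶠ x : ℕ in atTop,
      (#((Icc 1 x).filter fun n : ℕ => ∃ m : ℕ, (g.eval (n : ℤ)).natAbs = m ^ k) : ℝ)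
        * Real.log x ≤ δ * x := by
  have hk0 : (0 : ℝ) < k := by exact_mod_cast (show 0 < k by omega)
  set d := g.natDegree with hd
  -- `s = ⌊d/k⌋ + 1`, `q = s (s + 1)`, the exponent `e = d/k - s < 0`
  set s : ℕ := d / k + 1 with hs
  have hs1 : 1 ≤ s := Nat.le_add_left 1 (d / k)
  have hks : d < k * s := by rw [hs]; exact Nat.lt_mul_div_succ d (by omega)
  set q : ℕ := s * (s + 1) with hq
  have hq0 : q ≠ 0 := by rw [hq]; positivity
  have hq0R : (0 : ℝ) < q := by exact_mod_cast Nat.pos_of_ne_zero hq0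
  have hs0R : (0 : ℝ) < s := by exact_mod_cast hs1
  set e : ℝ := (d : ℝ) / k - s with he
  have he0 : e < 0 := by
    rw [he, sub_neg, div_lt_iff₀ hk0]
    exact_mod_cast (show d < s * k by rw [mul_comm]; exact hks)
  set ε₁ : ℝ := e / 2 * ((q : ℕ) : ℝ)⁻¹ with hε₁
  have hε₁0 : ε₁ < 0 := by
    rw [hε₁]; exact mul_neg_of_neg_of_pos (by linarith) (by positivity)
  set η : ℝ := -ε₁ with hη
  have hη0 : 0 < η := by rw [hη]; linarith
  obtain ⟨T₁, M, hT₁, hM, hsp⟩ := exists_spacing_powValues_all (separable_map_real_of_irreducible hirr hdeg)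
    hdeg hlc hk s hs1 hks.le
  -- `log x ≤ c x^r` eventually (`r, c > 0`)
  have hlogr : ∀ {r c : ℝ}, 0 < r → 0 < c → ∀ᶠ x : ℕ in atTop, Real.log x ≤ c * (x : ℝ) ^ r := by
    intro r c hr hc
    have h := ((isLittleO_log_rpow_atTop hr).comp_tendsto tendsto_natCast_atTop_atTop).def hc
    filter_upwards [h] with x hx
    simp only [Function.comp_apply, Real.norm_eq_abs] at hx
    rw [abs_of_nonneg (Real.rpow_nonneg (Nat.cast_nonneg x) r)] at hx
    exact (le_abs_self _).trans hx
  have hlog1 : ∀ {c : ℝ}, 0 < c → ∀ᶠ x : ℕ in atTop, Real.log x ≤ c * (x : ℝ) := by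
    intro c hc
    filter_upwards [hlogr one_pos hc] with x hx
    rwa [Real.rpow_one] at hx
  -- the constant `K = M^{1/q}` of the main term `s K x^{1-η}`
  set K : ℝ := M ^ ((q : ℕ) : ℝ)⁻¹ with hK
  have hK0 : 0 < K := by rw [hK]; exact Real.rpow_pos_of_pos hM _
  set n₁ : ℕ := ⌈T₁⌉₊ with hn₁
  have E1 := hlogr (show (0 : ℝ) < 1 / 2 by norm_num) (show 0 < δ / 4 by positivity)
  have E2 := hlog1 (show 0 < δ / 4 / (n₁ + 1 + s) by positivity)
  have E3 := hlogr hη0 (show 0 < δ / 4 / (s * K) by positivity)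
  filter_upwards [E1, E2, E3, eventually_ge_atTop (max n₁ 3)] with x hx1 hx2 hx3 hx
  have hxn₁ : n₁ ≤ x := (le_max_left _ _).trans hx
  have hx3' : 3 ≤ x := (le_max_right _ _).trans hx
  have hxpos : (0 : ℝ) < x := by exact_mod_cast (show 0 < x by omega)
  have hlog : 0 ≤ Real.log x := Real.log_nonneg (by exact_mod_cast (show 1 ≤ x by omega))
  -- the threshold `N₀ = max n₁ (⌊√x⌋ + 1)`
  set N₀ : ℕ := max n₁ (⌊Real.sqrt x⌋₊ + 1) with hN₀
  have hN₀n₁ : n₁ ≤ N₀ := le_max_left _ _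
  have hT₁N₀ : T₁ ≤ (N₀ : ℝ) := (Nat.le_ceil T₁).trans (by exact_mod_cast hN₀n₁)
  have hsqrt_le : Real.sqrt x ≤ N₀ := by
    have h1 : Real.sqrt x < (⌊Real.sqrt x⌋₊ : ℝ) + 1 := Nat.lt_floor_add_one _
    have h2 : ((⌊Real.sqrt x⌋₊ + 1 : ℕ) : ℝ) ≤ N₀ := by exact_mod_cast le_max_right _ _
    push_cast at h2
    linarith
  have hN₀le : (N₀ : ℝ) ≤ n₁ + Real.sqrt x + 1 := by
    have h1 : N₀ ≤ n₁ + (⌊Real.sqrt x⌋₊ + 1) := max_le (Nat.le_add_right _ _) (Nat.le_add_left _ _)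
    have h2 : (N₀ : ℝ) ≤ n₁ + (⌊Real.sqrt x⌋₊ + 1) := by exact_mod_cast h1
    have h3 : (⌊Real.sqrt x⌋₊ : ℝ) ≤ Real.sqrt x := Nat.floor_le (Real.sqrt_nonneg _)
    linarith
  have hN₀x : N₀ ≤ x := by
    refine max_le hxn₁ ?_
    have hx3r : (3 : ℝ) ≤ x := by exact_mod_cast hx3'
    have hsx : Real.sqrt x + 1 ≤ x := by
      have hs1 : Real.sqrt x ≤ (x : ℝ) / 2 + 1 / 2 := by
        rw [Real.sqrt_le_left (by positivity)]
        nlinarith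
      nlinarith [Real.sq_sqrt hxpos.le, Real.sqrt_nonneg (x : ℝ)]
    have h1 : ((⌊Real.sqrt x⌋₊ + 1 : ℕ) : ℝ) ≤ x := by
      push_cast
      linarith [Nat.floor_le (Real.sqrt_nonneg (x : ℝ))]
    exact_mod_cast h1
  have hN₀pos : (0 : ℝ) < N₀ := by linarith
  -- the spacing `L = (c⁻¹)^{1/q}`, `c = M N₀^e`, on `[N₀, x]`
  set c : ℝ := M * (N₀ : ℝ) ^ e with hc
  have hc0 : 0 < c := by rw [hc]; exact mul_pos hM (Real.rpow_pos_of_pos hN₀pos e)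
  set L : ℝ := c⁻¹ ^ ((q : ℕ) : ℝ)⁻¹ with hL
  have hL0 : 0 < L := by rw [hL]; exact Real.rpow_pos_of_pos (inv_pos.mpr hc0) _
  set T := (Icc N₀ x).filter (fun n : ℕ => ∃ m : ℕ, (g.eval (n : ℤ)).natAbs = m ^ k) with hT
  have hTsub : T ⊆ Icc N₀ x := filter_subset _ _
  have hsep : ∀ a ∈ T, ∀ b ∈ T, a ≤ b → s + 1 ≤ #(T.filter fun n => a ≤ n ∧ n ≤ b) →
      L ≤ (b : ℝ) - a := by
    intro a ha b hb hab hcard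
    obtain ⟨n, hn, hnS⟩ := exists_strictMono_mem_of_le_card hcard
    have hnT : ∀ i, n i ∈ T := fun i => (mem_filter.mp (hnS i)).1
    have hN₀n : (N₀ : ℝ) ≤ n 0 := by exact_mod_cast (mem_Icc.mp (hTsub (hnT 0))).1
    have hsol : ∀ i, ∃ m : ℕ, (g.eval (n i : ℤ)).natAbs = m ^ k := fun i => (mem_filter.mp (hnT i)).2
    have h1 := hsp N₀ hT₁N₀ n hn hN₀n hsol
    rw [← hd, ← he, ← hc, ← hq] at h1
    have han : (a : ℝ) ≤ n 0 := by exact_mod_cast (mem_filter.mp (hnS 0)).2.1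
    have hnb : (n (Fin.last s) : ℝ) ≤ b := by exact_mod_cast (mem_filter.mp (hnS (Fin.last s))).2.2
    have hW : 0 ≤ (n (Fin.last s) : ℝ) - n 0 := by
      have := hn.monotone (Fin.zero_le (Fin.last s))
      exact sub_nonneg.mpr (by exact_mod_cast this)
    have h2 := inv_rpow_inv_le_of_one_le_mul hq0 hc0 hW h1
    rw [← hL] at h2
    linarith
  have hcardT := card_le_mul_of_block_spacing hTsub hN₀x hL0 s hsep
  -- `1/L ≤ K x^{ε₁}`: from `N₀ ≥ √x` and `e < 0`
  have hinvL : 1 / L ≤ K * (x : ℝ) ^ ε₁ := by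
    have hsx : 0 < Real.sqrt x := Real.sqrt_pos.mpr hxpos
    have h1 : (N₀ : ℝ) ^ e ≤ (Real.sqrt x) ^ e := Real.rpow_le_rpow_of_nonpos hsx hsqrt_le he0.le
    have h2 : (Real.sqrt x) ^ e = (x : ℝ) ^ (e / 2) := by
      rw [Real.sqrt_eq_rpow, ← Real.rpow_mul hxpos.le]
      congr 1
      ring
    have hcle : c ≤ M * (x : ℝ) ^ (e / 2) := by
      rw [hc, ← h2]
      exact mul_le_mul_of_nonneg_left h1 hM.le
    have hinv : 1 / L = c ^ ((q : ℕ) : ℝ)⁻¹ := by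
      rw [hL, one_div, ← Real.inv_rpow (inv_nonneg.mpr hc0.le), inv_inv]
    rw [hinv, hK]
    calc c ^ ((q : ℕ) : ℝ)⁻¹ ≤ (M * (x : ℝ) ^ (e / 2)) ^ ((q : ℕ) : ℝ)⁻¹ :=
          Real.rpow_le_rpow hc0.le hcle (by positivity)
      _ = M ^ ((q : ℕ) : ℝ)⁻¹ * ((x : ℝ) ^ (e / 2)) ^ ((q : ℕ) : ℝ)⁻¹ :=
          Real.mul_rpow hM.le (by positivity)
      _ = M ^ ((q : ℕ) : ℝ)⁻¹ * (x : ℝ) ^ ε₁ := by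
          rw [← Real.rpow_mul hxpos.le]
  -- the main term
  have hmain : ((x : ℝ) - N₀) / L * Real.log x ≤ K * (x : ℝ) ^ ε₁ * x * Real.log x := by
    have h1 : ((x : ℝ) - N₀) / L ≤ (x : ℝ) * (1 / L) := by
      rw [mul_one_div]
      exact div_le_div_of_nonneg_right (by linarith) hL0.le
    have h2 : (x : ℝ) * (1 / L) ≤ x * (K * (x : ℝ) ^ ε₁) := mul_le_mul_of_nonneg_left hinvL hxpos.le
    nlinarith [h1.trans h2, hlog]
  have hxe : (x : ℝ) ^ ε₁ * (x : ℝ) ^ η = 1 := by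
    rw [← Real.rpow_add hxpos, hη, add_neg_cancel, Real.rpow_zero]
  -- assemble: `#S ≤ N₀ + #T ≤ (n₁ + √x + 1) + s ((x - N₀)/L + 1)`
  have hsplit : (#((Icc 1 x).filter fun n : ℕ => ∃ m : ℕ, (g.eval (n : ℤ)).natAbs = m ^ k) : ℝ)
      ≤ N₀ + #T := by
    have hsub : (Icc 1 x).filter (fun n : ℕ => ∃ m : ℕ, (g.eval (n : ℤ)).natAbs = m ^ k)
        ⊆ range N₀ ∪ T := by
      intro n hn
      obtain ⟨hnI, hmn⟩ := mem_filter.mp hn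
      rw [mem_union]
      by_cases hnN : n < N₀
      · exact Or.inl (mem_range.mpr hnN)
      · exact Or.inr (mem_filter.mpr ⟨mem_Icc.mpr ⟨not_lt.mp hnN, (mem_Icc.mp hnI).2⟩, hmn⟩)
    have h := (card_le_card hsub).trans (card_union_le _ _)
    rw [card_range] at h
    exact_mod_cast h
  have hA : ((n₁ : ℝ) + 1 + s) * Real.log x ≤ δ / 4 * x := by
    calc ((n₁ : ℝ) + 1 + s) * Real.log x ≤ ((n₁ : ℝ) + 1 + s) * (δ / 4 / (n₁ + 1 + s) * x) :=
          mul_le_mul_of_nonneg_left hx2 (by positivity)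
      _ = δ / 4 * x := by field_simp
  have hB : Real.sqrt x * Real.log x ≤ δ / 4 * x := by
    rw [Real.sqrt_eq_rpow]
    calc (x : ℝ) ^ (1 / 2 : ℝ) * Real.log x ≤ (x : ℝ) ^ (1 / 2 : ℝ) * (δ / 4 * (x : ℝ) ^ (1 / 2 : ℝ)) :=
          mul_le_mul_of_nonneg_left hx1 (by positivity)
      _ = δ / 4 * ((x : ℝ) ^ (1 / 2 : ℝ) * (x : ℝ) ^ (1 / 2 : ℝ)) := by ring
      _ = δ / 4 * x := by
          rw [← Real.rpow_add hxpos, show (1 / 2 : ℝ) + 1 / 2 = 1 by norm_num, Real.rpow_one]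
  have hC : (s : ℝ) * (((x : ℝ) - N₀) / L * Real.log x) ≤ δ / 4 * x := by
    calc (s : ℝ) * (((x : ℝ) - N₀) / L * Real.log x) ≤ s * (K * (x : ℝ) ^ ε₁ * x * Real.log x) :=
          mul_le_mul_of_nonneg_left hmain hs0R.le
      _ ≤ s * (K * (x : ℝ) ^ ε₁ * x * (δ / 4 / (s * K) * (x : ℝ) ^ η)) := by
          gcongr
      _ = δ / 4 * x * ((x : ℝ) ^ ε₁ * (x : ℝ) ^ η) := by
          field_simp
      _ = δ / 4 * x := by rw [hxe, mul_one]
  calc (#((Icc 1 x).filter fun n : ℕ => ∃ m : ℕ, (g.eval (n : ℤ)).natAbs = m ^ k) : ℝ) * Real.log x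
      ≤ ((N₀ : ℝ) + #T) * Real.log x := mul_le_mul_of_nonneg_right hsplit hlog
    _ ≤ ((n₁ + Real.sqrt x + 1) + s * (((x : ℝ) - N₀) / L + 1)) * Real.log x :=
        mul_le_mul_of_nonneg_right (add_le_add hN₀le hcardT) hlog
    _ = ((n₁ : ℝ) + 1 + s) * Real.log x + Real.sqrt x * Real.log x
          + s * (((x : ℝ) - N₀) / L * Real.log x) := by ring
    _ ≤ δ / 4 * x + δ / 4 * x + δ / 4 * x := add_le_add_three hA hB hC
    _ ≤ δ * x := by
        have : 0 ≤ δ * x := by positivity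
        linarith

end Summit.Parity.BatemanHorn.Theorems
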